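import Mathlib.NumberTheory.Padics.PadicVal.Basic
import Mathlib.NumberTheory.Multiplicity
import Literature.NumberTheory.EllipticCurves.Wiles2000
import Literature.NumberTheory.EllipticCurves.BSDAnalyticRankProofs
import Literature.NumberTheory.EllipticCurves.MordellWeilRankZeroProofs
import HarnessLib

/-!
# Wiles (Clay 2000), §1: "`C_n(ℚ)` is infinite `⟺ n` is a congruent number" — proof

Sibling proof file of `Literature.NumberTheory.EllipticCurves.Wiles2000` discharging its named fact
`Literature.NumberTheory.EllipticCurves.Wiles2000.infinite_point_iff_isCongruentNumber` (Wiles, *The Birch and Swinnerton-Dyer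
conjecture*, Clay 2000, §1 p. 3): for a positive integer `n` and the curve
`C_n = E_n : y² = x³ - n²x` (`Literature.congruentNumberCurve n`), `E_n(ℚ)` is infinite iff `n` is the
area of a right triangle with rational sides (`Literature.BSD.IsCongruentNumber n`). The printed
reference proof is Top–Yui, *Congruent number problems and their variants* (MSRI Publ. 44, 2008),
Prop. 3.3: for `n` squarefree, (i) `n` congruent ⟺ (ii) `E_n(ℚ)` has a point `(x, y)` with
`y ≠ 0` ⟺ (iii) `E_n(ℚ)` is infinite (⟺ (iv) rank `≥ 1`); Koblitz, *Introduction to Elliptic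
Curves and Modular Forms*, Ch. I §1 and §9.

* (iii) ⇒ (i) (`n ≠ 0`) is `Literature.NumberTheory.EllipticCurves.isCongruentNumber_of_infinite_point` of
  `Literature.NumberTheory.EllipticCurves.BSDAnalyticRankProofs` (infinitely many points force one
  with `y ≠ 0`, and `(x, y)`, `y ≠ 0`, gives the triangle `|(x² - n²)/y|`, `|2nx/y|`, `(x² + n²)/|y|`).
* (i) ⇒ (ii): a right triangle `(a, b, c)` of area `n` gives Koblitz's point
  `(nb/(c - a), 2n²/(c - a))` of `E_n` (`exists_nonsingular_ne_zero_of_isCongruentNumber`); no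
  squarefreeness is needed.
* (ii) ⇒ (iii) (`infinite_point_of_nonsingular`): Top–Yui and Koblitz show that a point with
  `y ≠ 0` is not torsion, the torsion of `E_n(ℚ)` being `E_n[2]` (reduction modulo primes
  `p ≡ 3 mod 4` and `#Ẽ_n(𝔽_p) = p + 1`, resp. Koblitz Ch. I §9 Prop. 17), which needs reduction
  theory and Dirichlet's theorem. We prove it instead by an elementary **`2`-adic descent on the
  duplication orbit**, valid for every `n ≥ 1`: on `E_n` the duplication formula reads
  `x(2P) = ((x² + n²)/(2y))²` (`congruentNumberCurve_two_smul`), and for the `2`-adic valuation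
  `v = v₂` one checks (three cases `v(x) <, =, > v(n)`; the middle one uses that odd squares are
  `1 mod 8`) that `v(x(2P)) < v(n)` whenever `y ≠ 0` (`padicValRat_doubleX_lt`), while
  `v(x) < v(n)` implies `v(x(2P)) = v(x) - 2` (`padicValRat_doubleX_of_lt`). Hence along
  `2P, 4P, 8P, …` the valuations `v(x)` decrease by `2` at each step, these points are pairwise
  distinct, and `E_n(ℚ)` is infinite. (A point with `v(x) < v(n)`, `x ≠ 0`, has `y ≠ 0` since the
  points with `y = 0` are `x ∈ {0, ±n}`: `congruentNumberCurve_y_ne_zero`.)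

Assembled: `Literature.NumberTheory.EllipticCurves.Wiles2000.infinite_point_iff_isCongruentNumber_holds`. With the Mordell–Weil
theorem, proved in the tree (`WeierstrassCurve.module_finite_point_holds`, whence
`WeierstrassCurve.mordellWeilRank_eq_zero_iff_finite`:  `rank_ℤ E(K) = 0 ↔ E(K)` finite,
`Literature.NumberTheory.EllipticCurves.MordellWeilRankZeroProofs`), the remaining equivalence
(iii) ⟺ (iv) of Top–Yui's Prop. 3.3 follows, and with it Koblitz's Prop. I.18 "`n` is a congruent
number iff `E_n(ℚ)` has nonzero rank" for every `n ≥ 1`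
(`mordellWeilRank_ne_zero_iff_isCongruentNumber`,
`exists_nonsingular_ne_zero_iff_isCongruentNumber`).

## Sources

* [Wiles2000] A. Wiles, *The Birch and Swinnerton-Dyer conjecture*, Clay Mathematics Institute
  (2000), §1 p. 3.
* [TopYui2008Congruent] J. Top, N. Yui, *Congruent number problems and their variants*, in
  *Algorithmic Number Theory*, MSRI Publ. 44, Cambridge Univ. Press (2008), 613–639, Prop. 3.3
  (p. 616; PDF p. 625 of `lit read book:buhler2008-algorithmic-number-theory-lattices-number-fields-curves`).
* [KoblitzECMF1993] N. Koblitz, *Introduction to Elliptic Curves and Modular Forms*, GTM 97,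
  Ch. I §1 (points and triangles), §9 (torsion of `E_n(ℚ)`).

## Design

* The `2`-adic bookkeeping uses Mathlib's `padicValRat 2` (junk value `0` at `0`, so every
  valuation statement carries its non-vanishing hypotheses) and `Int.eight_dvd_sq_sub_one_of_odd`.
* As in `BSDAnalyticRankProofs`, the group law on `(congruentNumberCurve n).toAffine.Point` is used
  only inside proofs; the statements mention `Infinite _` and `Nonsingular`, which are instance-free.
* Namespaces: curve lemmas in `Literature` with prefix `congruentNumberCurve_`; the valuation lemmas and the
  discharge in `Literature.Wiles2000`.
-/

noncomputable section

open scoped Classical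

open WeierstrassCurve

namespace Literature.NumberTheory.EllipticCurves

/-! ### The curve `E_n`: equation and duplication formula -/

/-- Transport of an affine point along an equality of its `x`-coordinate (bookkeeping for the
dependent constructor `Affine.Point.some`). [folklore] -/
theorem Affine.point_some_eq_of_eq {F : Type*} [Field F] {W : WeierstrassCurve F} {x x' y : F}
    (hx : x = x') (h : W.toAffine.Nonsingular x y) (h' : W.toAffine.Nonsingular x' y) :
    (Affine.Point.some x y h : W.toAffine.Point) = Affine.Point.some x' y h' := by
  subst hx
  rfl

/-- The equation of `E_n : y² = x³ - n²x` in solved form (Koblitz, Ch. I §2). [folklore] -/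
theorem congruentNumberCurve_equation_iff {n : ℕ} {x y : ℚ} :
    (congruentNumberCurve n).toAffine.Equation x y ↔ y ^ 2 = x ^ 3 - (n : ℚ) ^ 2 * x := by
  rw [Affine.equation_iff]
  simp only [congruentNumberCurve_a₁, congruentNumberCurve_a₂, congruentNumberCurve_a₃,
    congruentNumberCurve_a₄, congruentNumberCurve_a₆]
  constructor <;> intro h <;> linear_combination h

/-- **Duplication formula on `E_n`** (Koblitz, *Introduction to Elliptic Curves and Modular
Forms*, Ch. I §7–§9: `x(2P) = ((x² + n²)/2y)²` on `y² = x³ - n²x`). For an affine point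
`P = (x, y)` of `E_n` with `y ≠ 0`, `2P` is an affine point with `x`-coordinate
`((x² + n²)/(2y))²`: the tangent slope is `λ = (3x² - n²)/(2y)` and
`λ² - 2x = ((3x² - n²)² - 8x·y²)/(4y²) = (x² + n²)²/(4y²)` by the curve equation. [folklore] -/
theorem congruentNumberCurve_two_smul {n : ℕ} {x y : ℚ}
    (h : (congruentNumberCurve n).toAffine.Nonsingular x y) (hy : y ≠ 0) :
    ∃ (y' : ℚ) (h' : (congruentNumberCurve n).toAffine.Nonsingular
      (((x ^ 2 + (n : ℚ) ^ 2) / (2 * y)) ^ 2) y'),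
      (2 : ℕ) • (Affine.Point.some x y h : (congruentNumberCurve n).toAffine.Point) =
        Affine.Point.some _ y' h' := by
  have heq : y ^ 2 = x ^ 3 - (n : ℚ) ^ 2 * x := congruentNumberCurve_equation_iff.mp h.1
  have hneg : y ≠ (congruentNumberCurve n).toAffine.negY x y := by
    simp only [Affine.negY, congruentNumberCurve_a₁, congruentNumberCurve_a₃]
    intro h0
    apply hy
    linarith
  have h2y : (2 : ℚ) * y ≠ 0 := mul_ne_zero two_ne_zero hy
  have hL : (congruentNumberCurve n).toAffine.slope x x y y =
      (3 * x ^ 2 - (n : ℚ) ^ 2) / (2 * y) := by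
    rw [Affine.slope_of_Y_ne rfl hneg]
    simp only [Affine.negY, congruentNumberCurve_a₁, congruentNumberCurve_a₂,
      congruentNumberCurve_a₃, congruentNumberCurve_a₄]
    ring
  have hX : (congruentNumberCurve n).toAffine.addX x x
      ((congruentNumberCurve n).toAffine.slope x x y y) =
        ((x ^ 2 + (n : ℚ) ^ 2) / (2 * y)) ^ 2 := by
    rw [hL]
    simp only [Affine.addX, congruentNumberCurve_a₁, congruentNumberCurve_a₂, zero_mul, add_zero,
      sub_zero]
    rw [div_pow, div_pow, eq_div_iff (pow_ne_zero 2 h2y), sub_mul, sub_mul,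
      div_mul_cancel₀ _ (pow_ne_zero 2 h2y)]
    linear_combination (-(8 : ℚ) * x) * heq
  refine ⟨(congruentNumberCurve n).toAffine.addY x x y
      ((congruentNumberCurve n).toAffine.slope x x y y),
    hX ▸ Affine.nonsingular_add h h (fun hxy => hneg hxy.2), ?_⟩
  rw [two_nsmul, Affine.Point.add_self_of_Y_ne hneg]
  exact Affine.point_some_eq_of_eq hX _ _

/-- On `E_n`, an affine point `(x, y)` with `y ≠ 0` has `x ≠ 0` (`x = 0` forces `y² = 0`;
`(0, 0)` is a point of order `2`, Koblitz Ch. I §9). [folklore] -/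
theorem congruentNumberCurve_x_ne_zero {n : ℕ} {x y : ℚ}
    (heq : y ^ 2 = x ^ 3 - (n : ℚ) ^ 2 * x) (hy : y ≠ 0) : x ≠ 0 := by
  rintro rfl
  apply hy
  have : y ^ 2 = 0 := by rw [heq]; ring
  exact pow_eq_zero_iff two_ne_zero |>.mp this

/-- On `E_n`, an affine point `(x, y)` with `x ≠ 0` and `v₂(x) < v₂(n)` has `y ≠ 0`: indeed
`y² = x(x - n)(x + n)` and `x ∉ {0, n, -n}`, the `x`-coordinates of the points of order `2`
(Koblitz, Ch. I §9), because `v₂(±n) = v₂(n)`. [folklore] -/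
theorem congruentNumberCurve_y_ne_zero {n : ℕ} {x y : ℚ}
    (heq : y ^ 2 = x ^ 3 - (n : ℚ) ^ 2 * x) (hx : x ≠ 0)
    (hv : padicValRat 2 x < padicValRat 2 (n : ℚ)) : y ≠ 0 := by
  intro hy
  have hxn : x - n ≠ 0 := by
    intro h0
    rw [sub_eq_zero.mp h0] at hv
    exact lt_irrefl _ hv
  have hxn' : x + n ≠ 0 := by
    intro h0
    rw [eq_neg_of_add_eq_zero_left h0, padicValRat.neg] at hv
    exact lt_irrefl _ hv
  have h0 : x * (x - n) * (x + n) = 0 := by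
    have : x ^ 3 - (n : ℚ) ^ 2 * x = 0 := by rw [← heq, hy]; ring
    linear_combination this
  rcases mul_eq_zero.mp h0 with h | h
  · rcases mul_eq_zero.mp h with h | h
    · exact hx h
    · exact hxn h
  · exact hxn' h

namespace Wiles2000

/-! ### `2`-adic valuations of rationals -/

/-- `v₂(2) = 1` for the `2`-adic valuation `padicValRat 2` on `ℚ`. [folklore] -/
theorem padicValRat_two_two : padicValRat 2 (2 : ℚ) = 1 := by
  simpa using padicValRat.self (p := 2) one_lt_two

/-- `v₂(2^m) = m`. [folklore] -/
theorem padicValRat_two_pow (m : ℕ) : padicValRat 2 ((2 : ℚ) ^ m) = m := by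
  rw [padicValRat.pow, padicValRat_two_two, mul_one]

/-- `v₂(4^m) = 2m`. [folklore] -/
theorem padicValRat_four_pow (m : ℕ) : padicValRat 2 ((4 : ℚ) ^ m) = 2 * m := by
  rw [show (4 : ℚ) = 2 ^ 2 by norm_num, ← pow_mul, padicValRat_two_pow]
  push_cast
  ring

/-- A nonzero rational of `2`-adic valuation `0` (a `2`-adic unit) has odd numerator and odd
denominator: `v₂(u) = v₂(num) - v₂(den)` and `gcd(num, den) = 1`. [folklore] -/
theorem not_two_dvd_num_den {u : ℚ} (hu : u ≠ 0) (hv : padicValRat 2 u = 0) :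
    ¬ (2 : ℤ) ∣ u.num ∧ ¬ 2 ∣ u.den := by
  have hnum : u.num ≠ 0 := Rat.num_ne_zero.mpr hu
  rw [padicValRat_def] at hv
  by_cases hden : 2 ∣ u.den
  · exfalso
    have h1 : padicValNat 2 u.den ≠ 0 := by
      rw [Ne, padicValNat.eq_zero_iff]
      push Not
      exact ⟨by norm_num, u.den_ne_zero, hden⟩
    have h2 : padicValInt 2 u.num ≠ 0 := by omega
    have h3 : (2 : ℤ) ∣ u.num := by
      by_contra h
      exact h2 (padicValInt.eq_zero_of_not_dvd h)
    have h4 : 2 ∣ u.num.natAbs := Int.natAbs_dvd_natAbs.mpr h3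
    have h5 : 2 ∣ Nat.gcd u.num.natAbs u.den := Nat.dvd_gcd h4 hden
    rw [Nat.Coprime.gcd_eq_one u.reduced] at h5
    exact absurd (Nat.le_of_dvd one_pos h5) (by norm_num)
  · have h1 : padicValNat 2 u.den = 0 := padicValNat.eq_zero_of_not_dvd hden
    have h2 : padicValInt 2 u.num = 0 := by omega
    refine ⟨fun h => ?_, hden⟩
    rw [padicValInt.eq_zero_iff] at h2
    rcases h2 with h2 | h2 | h2
    · norm_num at h2
    · exact hnum h2
    · exact h2 (by exact_mod_cast h)

/-- For a rational `2`-adic unit `u` with `u² ≠ 1`, `v₂(u² - 1) ≥ 3`: with `u = p/q`, `p, q` odd,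
`u² - 1 = (p² - q²)/q²` and `8 ∣ p² - q²` since odd squares are `1 mod 8`
(`Int.eight_dvd_sq_sub_one_of_odd`). [folklore] -/
theorem three_le_padicValRat_sq_sub_one {u : ℚ} (hu : u ≠ 0) (hv : padicValRat 2 u = 0)
    (h1 : u ^ 2 - 1 ≠ 0) : 3 ≤ padicValRat 2 (u ^ 2 - 1) := by
  obtain ⟨hnum, hden⟩ := not_two_dvd_num_den hu hv
  have hnumodd : Odd u.num := by
    rwa [← Int.not_even_iff_odd, even_iff_two_dvd]
  have hdenodd : Odd (u.den : ℤ) := by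
    rw [← Int.not_even_iff_odd, even_iff_two_dvd]
    exact_mod_cast hden
  have h8 : (8 : ℤ) ∣ u.num ^ 2 - (u.den : ℤ) ^ 2 := by
    have e : u.num ^ 2 - (u.den : ℤ) ^ 2 = (u.num ^ 2 - 1) - ((u.den : ℤ) ^ 2 - 1) := by ring
    exact e ▸ dvd_sub (Int.eight_dvd_sq_sub_one_of_odd hnumodd)
      (Int.eight_dvd_sq_sub_one_of_odd hdenodd)
  have hden' : (u.den : ℚ) ≠ 0 := by exact_mod_cast u.den_ne_zero
  have hrepr : u ^ 2 - 1 = ((u.num ^ 2 - (u.den : ℤ) ^ 2 : ℤ) : ℚ) / (u.den : ℚ) ^ 2 := by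
    push_cast
    rw [show (u.num : ℚ) = u * u.den from (Rat.mul_den_eq_num u).symm]
    field_simp
  have hN : (u.num ^ 2 - (u.den : ℤ) ^ 2 : ℤ) ≠ 0 := by
    intro h0
    apply h1
    rw [hrepr, h0]
    simp
  rw [hrepr, padicValRat.div (by exact_mod_cast hN) (pow_ne_zero 2 hden'), padicValRat.pow,
    padicValRat.of_int, padicValRat.of_nat, padicValNat.eq_zero_of_not_dvd hden]
  have h3 : 3 ≤ padicValInt 2 (u.num ^ 2 - (u.den : ℤ) ^ 2) := by
    have h8' : ((2 : ℕ) : ℤ) ^ 3 ∣ u.num ^ 2 - (u.den : ℤ) ^ 2 := by norm_num; exact h8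
    rcases (padicValInt_dvd_iff 3 _).mp h8' with h | h
    · exact absurd h hN
    · exact h
  push_cast
  omega

/-- Scaled version: if `v₂(x) = m` and `x² ≠ 4^m` then `v₂(x² - 4^m) ≥ 2m + 3` (apply
`three_le_padicValRat_sq_sub_one` to the unit `x/2^m`). [folklore] -/
theorem le_padicValRat_sq_sub_four_pow {x : ℚ} (hx : x ≠ 0) {m : ℕ}
    (hv : padicValRat 2 x = m) (hne : x ^ 2 - 4 ^ m ≠ 0) :
    2 * (m : ℤ) + 3 ≤ padicValRat 2 (x ^ 2 - 4 ^ m) := by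
  have h2 : (2 : ℚ) ^ m ≠ 0 := pow_ne_zero m two_ne_zero
  set u : ℚ := x / 2 ^ m with hu_def
  have hu : u ≠ 0 := div_ne_zero hx h2
  have hxu : x = 2 ^ m * u := by rw [hu_def]; field_simp
  have hvu : padicValRat 2 u = 0 := by
    rw [hu_def, padicValRat.div hx h2, padicValRat_two_pow, hv, sub_self]
  have hfac : x ^ 2 - 4 ^ m = (4 : ℚ) ^ m * (u ^ 2 - 1) := by
    rw [hxu, show (4 : ℚ) = 2 ^ 2 by norm_num, ← pow_mul]
    ring
  have hu1 : u ^ 2 - 1 ≠ 0 := by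
    intro h0
    apply hne
    rw [hfac, h0, mul_zero]
  rw [hfac, padicValRat.mul (pow_ne_zero m (by norm_num)) hu1, padicValRat_four_pow]
  have := three_le_padicValRat_sq_sub_one hu hvu hu1
  omega

/-- Lower bounds survive addition: the ultrametric inequality `v₂(A + B) ≥ min (v₂ A, v₂ B)`
(`padicValRat.min_le_padicValRat_add`), packaged with the degenerate cases `A = 0` or `B = 0`
(where `padicValRat` takes the junk value `0`). [folklore] -/
theorem le_padicValRat_add {k : ℤ} {A B : ℚ} (hA : A = 0 ∨ k ≤ padicValRat 2 A)
    (hB : B = 0 ∨ k ≤ padicValRat 2 B) (hAB : A + B ≠ 0) : k ≤ padicValRat 2 (A + B) := by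
  rcases hA with rfl | hA
  · rw [zero_add] at hAB ⊢
    exact hB.resolve_left hAB
  rcases hB with rfl | hB
  · rwa [add_zero]
  exact le_trans (le_min hA hB) (padicValRat.min_le_padicValRat_add hAB)

/-- Two rationals of the same `2`-adic valuation `m ≥ 0` have `v₂(x² + N²) = 2m + 1`: write
`x² + N² = 2·4^m + ((x² - 4^m) + (N² - 4^m))` with `v₂` of the bracket `≥ 2m + 3 > 2m + 1`
(`le_padicValRat_sq_sub_four_pow`; "a sum of two odd squares is `2 mod 8`"). [folklore] -/
theorem padicValRat_sq_add_sq_of_eq {x N : ℚ} (hx : x ≠ 0) (hN : N ≠ 0) {m : ℕ}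
    (hvx : padicValRat 2 x = m) (hvN : padicValRat 2 N = m) (hpos : x ^ 2 + N ^ 2 ≠ 0) :
    padicValRat 2 (x ^ 2 + N ^ 2) = 2 * m + 1 := by
  have h4 : (4 : ℚ) ^ m ≠ 0 := pow_ne_zero m (by norm_num)
  have hv4 : padicValRat 2 (2 * (4 : ℚ) ^ m) = 2 * m + 1 := by
    rw [padicValRat.mul two_ne_zero h4, padicValRat_two_two, padicValRat_four_pow]
    ring
  have hsplit : x ^ 2 + N ^ 2 = 2 * 4 ^ m + ((x ^ 2 - 4 ^ m) + (N ^ 2 - 4 ^ m)) := by ring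
  by_cases hS : (x ^ 2 - 4 ^ m) + (N ^ 2 - 4 ^ m) = 0
  · rw [hsplit, hS, add_zero, hv4]
  have hA : x ^ 2 - 4 ^ m = 0 ∨ 2 * (m : ℤ) + 3 ≤ padicValRat 2 (x ^ 2 - 4 ^ m) := by
    by_cases h : x ^ 2 - 4 ^ m = 0
    · exact Or.inl h
    · exact Or.inr (le_padicValRat_sq_sub_four_pow hx hvx h)
  have hB : N ^ 2 - 4 ^ m = 0 ∨ 2 * (m : ℤ) + 3 ≤ padicValRat 2 (N ^ 2 - 4 ^ m) := by
    by_cases h : N ^ 2 - 4 ^ m = 0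
    · exact Or.inl h
    · exact Or.inr (le_padicValRat_sq_sub_four_pow hN hvN h)
  have hSv : 2 * (m : ℤ) + 3 ≤ padicValRat 2 ((x ^ 2 - 4 ^ m) + (N ^ 2 - 4 ^ m)) :=
    le_padicValRat_add hA hB hS
  rw [hsplit, padicValRat.add_eq_of_lt (hsplit ▸ hpos) (mul_ne_zero two_ne_zero h4) hS
    (by rw [hv4]; omega), hv4]

/-- Two rationals of the same `2`-adic valuation `m ≥ 0` with `x² ≠ N²` have
`v₂(x² - N²) ≥ 2m + 3`: `x² - N² = (x² - 4^m) - (N² - 4^m)` ("a difference of two odd squares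
is `0 mod 8`"). [folklore] -/
theorem le_padicValRat_sq_sub_sq_of_eq {x N : ℚ} (hx : x ≠ 0) (hN : N ≠ 0) {m : ℕ}
    (hvx : padicValRat 2 x = m) (hvN : padicValRat 2 N = m) (hne : x ^ 2 - N ^ 2 ≠ 0) :
    2 * (m : ℤ) + 3 ≤ padicValRat 2 (x ^ 2 - N ^ 2) := by
  have hsplit : x ^ 2 - N ^ 2 = (x ^ 2 - 4 ^ m) + (-(N ^ 2 - 4 ^ m)) := by ring
  have hA : x ^ 2 - 4 ^ m = 0 ∨ 2 * (m : ℤ) + 3 ≤ padicValRat 2 (x ^ 2 - 4 ^ m) := by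
    by_cases h : x ^ 2 - 4 ^ m = 0
    · exact Or.inl h
    · exact Or.inr (le_padicValRat_sq_sub_four_pow hx hvx h)
  have hB : -(N ^ 2 - 4 ^ m) = 0 ∨ 2 * (m : ℤ) + 3 ≤ padicValRat 2 (-(N ^ 2 - 4 ^ m)) := by
    by_cases h : N ^ 2 - 4 ^ m = 0
    · exact Or.inl (by rw [h, neg_zero])
    · rw [padicValRat.neg]
      exact Or.inr (le_padicValRat_sq_sub_four_pow hN hvN h)
  rw [hsplit]
  exact le_padicValRat_add hA hB (hsplit ▸ hne)

/-- **Descent step.** On `y² = x³ - N²x` (`N ≠ 0`, `y ≠ 0`) the duplication `x`-coordinate is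
`x(2P) = ((x² + N²)/(2y))²` (`Literature.NumberTheory.EllipticCurves.congruentNumberCurve_two_smul`). If `v₂(x) < v₂(N)` then
`v₂(x(2P)) = v₂(x) - 2`: with `a = v₂(x)`, `v₂(x² + N²) = 2a` and `v₂(y²) = v₂(x³ - N²x) = 3a`
by the strict ultrametric inequality, so `v₂(x(2P)) = 2(2a - 1) - 3a = a - 2`. [folklore] -/
theorem padicValRat_doubleX_of_lt {x N y : ℚ} (hx : x ≠ 0) (hN : N ≠ 0) (hy : y ≠ 0)
    (heq : y ^ 2 = x ^ 3 - N ^ 2 * x) (hv : padicValRat 2 x < padicValRat 2 N) :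
    padicValRat 2 (((x ^ 2 + N ^ 2) / (2 * y)) ^ 2) = padicValRat 2 x - 2 := by
  have hx2 : x ^ 2 ≠ 0 := pow_ne_zero 2 hx
  have hN2 : N ^ 2 ≠ 0 := pow_ne_zero 2 hN
  have hsum : x ^ 2 + N ^ 2 ≠ 0 := by positivity
  have h1 : padicValRat 2 (x ^ 2 + N ^ 2) = 2 * padicValRat 2 x := by
    rw [padicValRat.add_eq_of_lt hsum hx2 hN2
      (by simp only [padicValRat.pow]; push_cast; linarith), padicValRat.pow]
    push_cast
    ring
  have e : x ^ 3 - N ^ 2 * x = x ^ 3 + -(N ^ 2 * x) := by ring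
  have hcube : x ^ 3 + -(N ^ 2 * x) ≠ 0 := by rw [← e, ← heq]; exact pow_ne_zero 2 hy
  have h2 : 2 * padicValRat 2 y = 3 * padicValRat 2 x := by
    have h := congrArg (padicValRat 2) heq
    rw [e, padicValRat.pow, padicValRat.add_eq_of_lt hcube (pow_ne_zero 3 hx)
      (neg_ne_zero.mpr (mul_ne_zero hN2 hx)) ?_, padicValRat.pow] at h
    · push_cast at h
      linarith
    · rw [padicValRat.neg, padicValRat.mul hN2 hx, padicValRat.pow, padicValRat.pow]
      push_cast
      linarith
  rw [padicValRat.pow, padicValRat.div hsum (mul_ne_zero two_ne_zero hy), h1,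
    padicValRat.mul two_ne_zero hy, padicValRat_two_two]
  push_cast
  linarith

/-- On `y² = x³ - N²x = x(x² - N²)`, `y ≠ 0` forces `x² ≠ N²`. [folklore] -/
theorem sq_sub_sq_ne_zero {x N y : ℚ} (hy : y ≠ 0) (heq : y ^ 2 = x ^ 3 - N ^ 2 * x) :
    x ^ 2 - N ^ 2 ≠ 0 := by
  intro h0
  apply hy
  have : y ^ 2 = 0 := by rw [heq]; linear_combination x * h0
  exact pow_eq_zero_iff two_ne_zero |>.mp this

/-- **First duplication.** On `y² = x³ - N²x` with `N ≠ 0`, `v₂(N) = m ≥ 0` and `y ≠ 0`, the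
duplication `x`-coordinate satisfies `v₂(x(2P)) < v₂(N)` (in fact `≤ m - 3`). Three cases on
`a = v₂(x)`: `a < m` gives `a - 2` (`padicValRat_doubleX_of_lt`); `a > m` gives
`v₂(x² + N²) = v₂(x² - N²) = 2m`, `v₂(y²) = a + 2m`, so `v₂(x(2P)) = 2m - 2 - a`; `a = m` gives
`v₂(x² + N²) = 2m + 1` and `v₂(x² - N²) ≥ 2m + 3` (`padicValRat_sq_add_sq_of_eq`,
`le_padicValRat_sq_sub_sq_of_eq`), `v₂(y²) = a + v₂(x² - N²) ≥ 3m + 3`, so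
`v₂(x(2P)) = 4m - v₂(y²) ≤ m - 3`. [folklore] -/
theorem padicValRat_doubleX_lt {x N y : ℚ} (hx : x ≠ 0) (hN : N ≠ 0) (hy : y ≠ 0)
    (heq : y ^ 2 = x ^ 3 - N ^ 2 * x) (hNv : 0 ≤ padicValRat 2 N) :
    padicValRat 2 (((x ^ 2 + N ^ 2) / (2 * y)) ^ 2) < padicValRat 2 N := by
  have hx2 : x ^ 2 ≠ 0 := pow_ne_zero 2 hx
  have hN2 : N ^ 2 ≠ 0 := pow_ne_zero 2 hN
  have hsum : x ^ 2 + N ^ 2 ≠ 0 := by positivity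
  have hdiff : x ^ 2 - N ^ 2 ≠ 0 := sq_sub_sq_ne_zero hy heq
  have hy2 : 2 * padicValRat 2 y = padicValRat 2 x + padicValRat 2 (x ^ 2 - N ^ 2) := by
    have h := congrArg (padicValRat 2) heq
    rw [show x ^ 3 - N ^ 2 * x = x * (x ^ 2 - N ^ 2) by ring, padicValRat.pow,
      padicValRat.mul hx hdiff] at h
    push_cast at h
    linarith
  have hX : padicValRat 2 (((x ^ 2 + N ^ 2) / (2 * y)) ^ 2) =
      2 * padicValRat 2 (x ^ 2 + N ^ 2) - 2 - 2 * padicValRat 2 y := by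
    rw [padicValRat.pow, padicValRat.div hsum (mul_ne_zero two_ne_zero hy),
      padicValRat.mul two_ne_zero hy, padicValRat_two_two]
    push_cast
    ring
  rcases lt_trichotomy (padicValRat 2 x) (padicValRat 2 N) with hlt | heqv | hgt
  · rw [padicValRat_doubleX_of_lt hx hN hy heq hlt]
    linarith
  · -- `v₂(x) = v₂(N) = m`
    obtain ⟨m, hm⟩ : ∃ m : ℕ, padicValRat 2 N = m :=
      ⟨(padicValRat 2 N).toNat, (Int.toNat_of_nonneg hNv).symm⟩
    have hvx : padicValRat 2 x = m := heqv.trans hm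
    have h1 := padicValRat_sq_add_sq_of_eq hx hN hvx hm hsum
    have h2 := le_padicValRat_sq_sub_sq_of_eq hx hN hvx hm hdiff
    rw [hX, h1, hm]
    linarith
  · -- `v₂(x) > v₂(N)`
    have h1 : padicValRat 2 (x ^ 2 + N ^ 2) = 2 * padicValRat 2 N := by
      rw [add_comm, padicValRat.add_eq_of_lt (by rwa [add_comm]) hN2 hx2
        (by simp only [padicValRat.pow]; push_cast; linarith), padicValRat.pow]
      push_cast
      ring
    have h3 : padicValRat 2 (x ^ 2 - N ^ 2) = 2 * padicValRat 2 N := by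
      have e : x ^ 2 - N ^ 2 = -(N ^ 2) + x ^ 2 := by ring
      rw [e, padicValRat.add_eq_of_lt (e ▸ hdiff) (neg_ne_zero.mpr hN2) hx2
        (by rw [padicValRat.neg]; simp only [padicValRat.pow]; push_cast; linarith),
        padicValRat.neg, padicValRat.pow]
      push_cast
      ring
    rw [hX, h1]
    linarith


/-! ### The duplication orbit and the discharge -/

/-- **A rational point with `y ≠ 0` makes `E_n(ℚ)` infinite** (Top–Yui, Prop. 3.3, (ii) ⇒ (iii),
stated there for squarefree `n`; Koblitz, Ch. I §9). The printed proofs show that such a point is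
not torsion, the torsion of `E_n(ℚ)` being `E_n[2]` (reduction modulo primes `p ≡ 3 mod 4`); the
proof here, valid for every `n ≠ 0`, is a `2`-adic descent on the duplication orbit: with
`P = (x, y)`, `v₂(x(2P)) < v₂(n)` (`padicValRat_doubleX_lt`), and once `v₂(x(Q)) < v₂(n)` each
further duplication lowers `v₂(x)` by exactly `2` (`padicValRat_doubleX_of_lt`; such `Q` has
`y ≠ 0` by `Literature.NumberTheory.EllipticCurves.congruentNumberCurve_y_ne_zero`), so the points `2^(k+1) P`, `k ∈ ℕ`, have
`v₂(x) = v₂(x(2P)) - 2k`, are pairwise distinct, and `k ↦ 2^(k+1) P` is injective.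
[cite: TopYui2008Congruent, Prop. 3.3 (ii) ⇒ (iii)] -/
theorem infinite_point_of_nonsingular {n : ℕ} (hn : n ≠ 0) {x y : ℚ}
    (h : (congruentNumberCurve n).toAffine.Nonsingular x y) (hy : y ≠ 0) :
    Infinite (congruentNumberCurve n).toAffine.Point := by
  have hN : (n : ℚ) ≠ 0 := by exact_mod_cast hn
  have hNv : 0 ≤ padicValRat 2 (n : ℚ) := by
    rw [padicValRat.of_nat]
    exact_mod_cast Nat.zero_le _
  obtain ⟨P, hP⟩ : ∃ P : (congruentNumberCurve n).toAffine.Point, P = Affine.Point.some x y h :=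
    ⟨_, rfl⟩
  obtain ⟨c, hc⟩ : ∃ c : ℤ, padicValRat 2 (((x ^ 2 + (n : ℚ) ^ 2) / (2 * y)) ^ 2) = c := ⟨_, rfl⟩
  have heq : y ^ 2 = x ^ 3 - (n : ℚ) ^ 2 * x := congruentNumberCurve_equation_iff.mp h.1
  have hx : x ≠ 0 := congruentNumberCurve_x_ne_zero heq hy
  have hcm : c < padicValRat 2 (n : ℚ) := hc ▸ padicValRat_doubleX_lt hx hN hy heq hNv
  -- the invariant along the duplication orbit `2^(k+1) • P = (x_k, y_k)`: `y_k ≠ 0`, `v₂(x_k) = c - 2k`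
  have key : ∀ k : ℕ, ∃ (xk yk : ℚ) (hk : (congruentNumberCurve n).toAffine.Nonsingular xk yk),
      (2 ^ (k + 1) : ℕ) • P = Affine.Point.some xk yk hk ∧ yk ≠ 0 ∧
        padicValRat 2 xk = c - 2 * k := by
    intro k
    induction k with
    | zero =>
      obtain ⟨y', h', hd⟩ := congruentNumberCurve_two_smul h hy
      refine ⟨_, y', h', by rw [hP, ← hd, zero_add, pow_one], ?_, by rw [hc]; simp⟩
      have hX0 : ((x ^ 2 + (n : ℚ) ^ 2) / (2 * y)) ^ 2 ≠ 0 := by positivity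
      exact congruentNumberCurve_y_ne_zero (congruentNumberCurve_equation_iff.mp h'.1) hX0
        (hc ▸ hcm)
    | succ k ih =>
      obtain ⟨xk, yk, hk, hPk, hyk, hvk⟩ := ih
      have heqk : yk ^ 2 = xk ^ 3 - (n : ℚ) ^ 2 * xk := congruentNumberCurve_equation_iff.mp hk.1
      have hxk : xk ≠ 0 := congruentNumberCurve_x_ne_zero heqk hyk
      have hvlt : padicValRat 2 xk < padicValRat 2 (n : ℚ) := by
        rw [hvk]
        have : (0 : ℤ) ≤ k := Int.natCast_nonneg k
        linarith
      have hvX : padicValRat 2 (((xk ^ 2 + (n : ℚ) ^ 2) / (2 * yk)) ^ 2) =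
          c - 2 * (k + 1 : ℕ) := by
        rw [padicValRat_doubleX_of_lt hxk hN hyk heqk hvlt, hvk]
        push_cast
        ring
      obtain ⟨y', h', hd⟩ := congruentNumberCurve_two_smul hk hyk
      refine ⟨_, y', h', by rw [pow_succ, mul_nsmul, hPk, hd], ?_, hvX⟩
      have hX : ((xk ^ 2 + (n : ℚ) ^ 2) / (2 * yk)) ^ 2 ≠ 0 := by positivity
      refine congruentNumberCurve_y_ne_zero (congruentNumberCurve_equation_iff.mp h'.1) hX ?_
      rw [hvX]
      have : (0 : ℤ) ≤ k := Int.natCast_nonneg k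
      push_cast
      linarith
  refine Infinite.of_injective (fun k : ℕ => (2 ^ (k + 1) : ℕ) • P) ?_
  intro k l hkl
  obtain ⟨xk, yk, hk, hPk, -, hvk⟩ := key k
  obtain ⟨xl, yl, hl, hPl, -, hvl⟩ := key l
  simp only at hkl
  rw [hPk, hPl] at hkl
  injection hkl with hx_eq
  have hkl' : (k : ℤ) = l := by
    have := congrArg (padicValRat 2) hx_eq
    rw [hvk, hvl] at this
    linarith
  exact_mod_cast hkl'

/-- **A congruent number gives a rational point of `E_n` with `y ≠ 0`** (Top–Yui, Prop. 3.3,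
(i) ⇒ (ii); Koblitz, Ch. I §1). To the right triangle `(a, b, c)` with rational sides and area
`ab/2 = n` attach Koblitz's point `(x, y) = (nb/(c - a), 2n²/(c - a))` of `E_n : y² = x³ - n²x`
(the inverse of `(x, y) ↦ ((x² - n²)/y, 2nx/y, (x² + n²)/y)`; Top–Yui use `((c/2)², c(a² - b²)/8)`
instead, which degenerates for `a = b`). Here `c - a ≠ 0` because `b ≠ 0`, the curve equation is
the identity `4n⁴(c - a) = n³b(b² - (c - a)²)`, i.e. `b² - (c - a)² = 2a(c - a)` given
`a² + b² = c²` and `ab = 2n`, and `y ≠ 0` because a congruent number is nonzero (`a, b > 0`). No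
squarefreeness is needed. [cite: TopYui2008Congruent, Prop. 3.3 (i) ⇒ (ii)] -/
theorem exists_nonsingular_ne_zero_of_isCongruentNumber {n : ℕ}
    (h : Literature.NumberTheory.EllipticCurves.IsCongruentNumber n) :
    ∃ x y : ℚ, (congruentNumberCurve n).toAffine.Nonsingular x y ∧ y ≠ 0 := by
  obtain ⟨a, b, c, ha, hb, hpyth, harea⟩ := h
  have hn : (n : ℚ) ≠ 0 := by
    intro h0
    rw [h0] at harea
    have hab : a * b = 0 := by linarith
    rcases mul_eq_zero.mp hab with h | h <;> linarith
  have hn' : n ≠ 0 := by exact_mod_cast hn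
  have hca : c - a ≠ 0 := by
    intro h0
    rw [sub_eq_zero.mp h0] at hpyth
    have hb2 : b ^ 2 = 0 := by linarith
    exact absurd (pow_eq_zero_iff two_ne_zero |>.mp hb2) hb.ne'
  haveI := isElliptic_congruentNumberCurve hn'
  refine ⟨n * b / (c - a), 2 * n ^ 2 / (c - a), ?_, div_ne_zero (by positivity) hca⟩
  rw [← Affine.equation_iff_nonsingular, congruentNumberCurve_equation_iff, div_pow, div_pow,
    eq_sub_iff_add_eq, mul_div_assoc', div_add_div _ _ (pow_ne_zero 2 hca) hca,
    div_eq_div_iff (mul_ne_zero (pow_ne_zero 2 hca) hca) (pow_ne_zero 3 hca)]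
  linear_combination (-(4 : ℚ) * n ^ 3 * (c - a) ^ 4) * harea +
    (-(n : ℚ) ^ 3 * b * (c - a) ^ 3) * hpyth

/-- **Wiles, Clay 2000, §1 p. 3: "`C_n(ℚ)` is infinite `⟺ n` is a congruent number"**, the
discharge of the named fact `Literature.NumberTheory.EllipticCurves.Wiles2000.infinite_point_iff_isCongruentNumber` (Top–Yui,
Prop. 3.3 (i) ⟺ (iii); Koblitz, Ch. I §9). For `0 < n`: (⇒) is
`Literature.NumberTheory.EllipticCurves.isCongruentNumber_of_infinite_point` (infinitely many points give one with `y ≠ 0`, hence a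
triangle); (⇐) is `exists_nonsingular_ne_zero_of_isCongruentNumber` followed by the `2`-adic
descent `infinite_point_of_nonsingular`.
[cite: Wiles2000, §1, p. 3] [cite: TopYui2008Congruent, Prop. 3.3] -/
theorem infinite_point_iff_isCongruentNumber_holds : infinite_point_iff_isCongruentNumber := by
  intro n hn
  refine ⟨isCongruentNumber_of_infinite_point hn.ne', fun h => ?_⟩
  obtain ⟨x, y, hxy, hy⟩ := exists_nonsingular_ne_zero_of_isCongruentNumber h
  exact infinite_point_of_nonsingular hn.ne' hxy hy

/-! ### Rank form (Top–Yui, Prop. 3.3 (iv); Koblitz, Ch. I §9, Prop. 18) -/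

/-- **`n` is congruent iff `E_n(ℚ)` has a point `(x, y)` with `y ≠ 0`** (Top–Yui, Prop. 3.3,
(i) ⟺ (ii), printed for squarefree `n`; here for every `n ≥ 1`): (⇐) is the triangle of
`Literature.NumberTheory.EllipticCurves.isCongruentNumber_of_equation`, (⇒) is `exists_nonsingular_ne_zero_of_isCongruentNumber`.
[cite: TopYui2008Congruent, Prop. 3.3 (i) ⟺ (ii)] -/
theorem exists_nonsingular_ne_zero_iff_isCongruentNumber {n : ℕ} (hn : 0 < n) :
    (∃ x y : ℚ, (congruentNumberCurve n).toAffine.Nonsingular x y ∧ y ≠ 0) ↔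
      Literature.NumberTheory.EllipticCurves.IsCongruentNumber n :=
  ⟨fun ⟨_, _, hxy, hy⟩ => isCongruentNumber_of_equation hn.ne' hxy.1 hy,
    exists_nonsingular_ne_zero_of_isCongruentNumber⟩

/-- **`n` is a congruent number iff `E_n(ℚ)` has nonzero rank** (Koblitz, *Introduction to
Elliptic Curves and Modular Forms*, Ch. I §9, Prop. 18; Top–Yui, Prop. 3.3, (i) ⟺ (iv): "the
rank of `C_n(ℚ)` is `≥ 1`", printed for squarefree `n`; here for every `n ≥ 1`). By the
Mordell–Weil theorem, proved in the tree (`WeierstrassCurve.mordellWeilRank_eq_zero_iff_finite`: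
`rank_ℤ E(ℚ) = 0 ↔ E(ℚ)` finite, from `WeierstrassCurve.module_finite_point_holds`), nonzero
rank is the same as `E_n(ℚ)` infinite (`E_n` is an elliptic curve for `n ≠ 0`,
`Literature.NumberTheory.EllipticCurves.isElliptic_congruentNumberCurve`), and `infinite_point_iff_isCongruentNumber_holds`
concludes. [cite: TopYui2008Congruent, Prop. 3.3 (i) ⟺ (iv)]
[cite: KoblitzECMF1993, Ch. I §9, Prop. 18] -/
theorem mordellWeilRank_ne_zero_iff_isCongruentNumber {n : ℕ} (hn : 0 < n) :
    (congruentNumberCurve n).mordellWeilRank ≠ 0 ↔ Literature.NumberTheory.EllipticCurves.IsCongruentNumber n := by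
  haveI := isElliptic_congruentNumberCurve hn.ne'
  rw [Ne, (congruentNumberCurve n).mordellWeilRank_eq_zero_iff_finite, ← not_infinite_iff_finite,
    not_not]
  exact infinite_point_iff_isCongruentNumber_holds hn

end Wiles2000

end Literature.NumberTheory.EllipticCurves

end
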